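import Mathlib
import HarnessLib
import Literature.ModelTheory.FiniteModelTheory.StructCkEquiv
import Summits.ValiantsHypothesis.ValiantsHypothesis.Theorems.SymmetryDialAffinePebble
import Summits.ValiantsHypothesis.ValiantsHypothesis.Theorems.SymmetryDialDisalignedCFI
import Summits.ValiantsHypothesis.ValiantsHypothesis.Theorems.SymmetryDialDisalignedCFIShear
import Summits.ValiantsHypothesis.ValiantsHypothesis.Theorems.SymmetryDialShearStrategy
import Summits.ValiantsHypothesis.ValiantsHypothesis.Theorems.SymmetryDialShearInvariant
import Summits.ValiantsHypothesis.ValiantsHypothesis.Theorems.SymmetryDialShearGame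

/-!
# Symmetry dial — the certifier's protection scheme, typed (NODE-g9 §B.2/§B.13, lens 1, g9)

The protection scheme `Prot` of the certifier `asc4.py` / `asc4c.c` (whose rank condition `COND_k` was
certified at `k = 3, d = 12, 18` and, for point configurations, exhaustively at `k = 4, d = 135` —
kit j339558), ported VERBATIM to Lean as computable `Bool`-valued data on positions of the pebble game,
so that the kernel theorem `SymmetryDialShearGame.affinePebbleEquiv_of_linear'` can be instantiated
with it: `affinePebbleEquiv_of_condLin` — for a Good design and symmetric twists, the `k`-pebble
equivalence of the compact CFI structures follows from the linear re-clearing condition FOR THIS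
SCHEME (stated inline; it is the existence form, over positions, of the certifier's `COND_k`).
Dictionary (asc4 ↔ Lean): configuration `(P, B)` ↦ the SETS `pinned s` (base points under point
pebbles) and `dualPeb s` (nonzero fibre functionals `fib ξ` under dual pebbles), `size = |P| + |B|`;
`star(P)` ↦ every pair with a pinned end; `E_span(B)` ↦ `eSpan` (an edge one of whose end functionals
is a nonzero element of the span of the pebbled functionals); `aff_frozen(Q)` ↦ `affFrozen` (edge
`(u, u+g)` with both ends outside `Q`, `|Q| ≥ 2`, `g ∈ span{q + u : q ∈ Q}` for one of its ends `u`);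
the case split on `size ≤ k − 2` / `size = k − 1` as in `Design.prot`.  The scheme contains the stars
(`protAsc_of_pinned_left/right`) and is empty on the empty board (`protAsc_empty`) — the two side
conditions of the kernel theorem; everything else is carried by the linear condition.
-/

set_option linter.dupNamespace false

namespace Summit.ValiantsHypothesis.ValiantsHypothesis.Theorems.SymmetryDialCondScheme

open Literature.ModelTheory.FiniteModelTheory
open SymmetryDialAffinePebble (V pair Laff affStr AffinePebbleEquiv)
open SymmetryDialDisalignedCFI (base fib Design cfiMat)
open SymmetryDialDisalignedCFIShear (cobd transp)
open SymmetryDialShearStrategy (ShearParam)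
open SymmetryDialShearInvariant (Pos)
open SymmetryDialShearGame (affinePebbleEquiv_of_linear')

variable {d₀ r δ : ℕ}

/-! ## §1 Configurations of a position -/

/-- The base point under a point pebble. -/
def pinBase : Option (V (d₀ + r) ⊕ V (d₀ + r)) → Option (V d₀)
  | some (.inl x) => some (base x)
  | _ => none

/-- The fibre functional under a dual pebble. -/
def dualFun : Option (V (d₀ + r) ⊕ V (d₀ + r)) → Option (V r)
  | some (.inr ξ) => some (fib ξ)
  | _ => none

/-- `P(s)`: the base point `v` is pinned in the position `s`. -/
def pinned {k : ℕ} (s : Pos k (d₀ + r)) (v : V d₀) : Bool :=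
  decide (∃ j : Fin k, pinBase (s j) = some v)

/-- `B(s)`: the nonzero functional `β` is carried by a dual pebble of `s`. -/
def dualPeb {k : ℕ} (s : Pos k (d₀ + r)) (β : V r) : Bool :=
  decide (β ≠ 0 ∧ ∃ j : Fin k, dualFun (s j) = some β)

/-- `size = |P(s)| + |B(s)|` (sets, not pebbles). -/
def size {k : ℕ} (s : Pos k (d₀ + r)) : ℕ :=
  (Finset.univ.filter fun v : V d₀ => pinned s v = true).card +
    (Finset.univ.filter fun β : V r => dualPeb s β = true).card

/-- `γ` is a NONZERO element of the span of the pebbled functionals other than `b` (`b = none`: of all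
of them). -/
def inSpanB {k : ℕ} (s : Pos k (d₀ + r)) (b : Option (V r)) (γ : V r) : Bool :=
  decide (γ ≠ 0 ∧ ∃ c : Fin k → Fin 2,
    γ = ∑ j, if c j = 1 ∧ dualFun (s j) ≠ b then (dualFun (s j)).getD 0 else 0)

/-- `E_span(B ∖ b)`: an edge one of whose end functionals lies in that span. -/
def eSpan {k : ℕ} (D : Design d₀ r δ) (s : Pos k (d₀ + r)) (b : Option (V r)) (v w : V d₀) : Bool :=
  decide (∃ i : Fin δ, w = v + D.gen i ∧ (inSpanB s b (D.lam v i) = true ∨ inSpanB s b (D.lam w i) = true))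

/-- `aff_frozen(Q)`, one orientation: `(u, u + g)` with `u, u + g ∉ Q`, `|Q| ≥ 2`, `g ∈ span{q + u}`. -/
def affFrozen₁ (D : Design d₀ r δ) (Q : V d₀ → Bool) (u w : V d₀) : Bool :=
  decide (2 ≤ (Finset.univ.filter fun q : V d₀ => Q q = true).card ∧ Q u = false ∧ Q w = false ∧
    ∃ i : Fin δ, w = u + D.gen i ∧ ∃ c : V d₀ → Fin 2,
      D.gen i = ∑ q, if c q = 1 ∧ Q q = true then q + u else 0)

/-- `aff_frozen(Q)` on the unordered edge. -/
def affFrozen (D : Design d₀ r δ) (Q : V d₀ → Bool) (v w : V d₀) : Bool :=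
  affFrozen₁ D Q v w || affFrozen₁ D Q w v

/-! ## §2 The protection scheme of the certifier -/

/-- `Prot` of `asc4.py` (`Design.prot`), as a function of the position: stars of the pinned points (all
pairs with a pinned end), and — by the case split on `size` — the span-protected and affinely frozen
edges of the configuration and of its one-element-smaller successors. -/
def protAsc (k : ℕ) (D : Design d₀ r δ) (s : Pos k (d₀ + r)) (v w : V d₀) : Bool :=
  pinned s v || pinned s w ||
    (decide (0 < size s) &&
      (if size s ≤ k - 2 then eSpan D s none v w || affFrozen D (pinned s) v w
       else if 0 < (Finset.univ.filter fun q : V d₀ => pinned s q = true).card then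
         eSpan D s none v w ||
           decide (∃ y : V d₀, pinned s y = true ∧
             affFrozen D (fun q => pinned s q && decide (q ≠ y)) v w = true) ||
           (decide (0 < (Finset.univ.filter fun β : V r => dualPeb s β = true).card) &&
             affFrozen D (pinned s) v w)
       else decide (∃ b : V r, dualPeb s b = true ∧ eSpan D s (some b) v w = true)))

/-- Stars are protected (left end pinned). -/
theorem protAsc_of_pinned_left {k : ℕ} (D : Design d₀ r δ) (s : Pos k (d₀ + r)) (v w : V d₀)
    (h : pinned s v = true) : protAsc k D s v w = true := by
  unfold protAsc; rw [h]; rfl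

/-- Stars are protected (right end pinned). -/
theorem protAsc_of_pinned_right {k : ℕ} (D : Design d₀ r δ) (s : Pos k (d₀ + r)) (v w : V d₀)
    (h : pinned s w = true) : protAsc k D s v w = true := by
  unfold protAsc; rw [h, Bool.or_true]; rfl

/-- A point pebble pins its base point. -/
theorem pinned_of_mem {k : ℕ} (s : Pos k (d₀ + r)) (j : Fin k) (x : V (d₀ + r))
    (h : s j = some (.inl x)) : pinned s (base x) = true := by
  unfold pinned; rw [decide_eq_true_eq]; exact ⟨j, by rw [h]; rfl⟩

/-- Nothing is pinned on the empty board. -/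
theorem pinned_empty {k : ℕ} (v : V d₀) :
    pinned (fun _ : Fin k => (none : Option (V (d₀ + r) ⊕ V (d₀ + r)))) v = false := by
  unfold pinned; rw [decide_eq_false_iff_not]; rintro ⟨j, hj⟩; simp [pinBase] at hj

/-- No dual is pebbled on the empty board. -/
theorem dualPeb_empty {k : ℕ} (β : V r) :
    dualPeb (fun _ : Fin k => (none : Option (V (d₀ + r) ⊕ V (d₀ + r)))) β = false := by
  unfold dualPeb; rw [decide_eq_false_iff_not]; rintro ⟨-, j, hj⟩; simp [dualFun] at hj

/-- The empty board has size `0`. -/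
theorem size_empty {k : ℕ} :
    size (fun _ : Fin k => (none : Option (V (d₀ + r) ⊕ V (d₀ + r)))) = 0 := by
  unfold size
  simp [pinned_empty, dualPeb_empty]

/-- Nothing is protected on the empty board. -/
theorem protAsc_empty {k : ℕ} (D : Design d₀ r δ) (v w : V d₀) :
    protAsc k D (fun _ : Fin k => (none : Option (V (d₀ + r) ⊕ V (d₀ + r)))) v w = false := by
  unfold protAsc
  rw [pinned_empty, pinned_empty, size_empty]
  rfl

/-! ## §3 (S4) for the certifier's scheme, modulo its linear condition -/

/-- **(S4) for the certifier's scheme.**  For a Good framed Cayley design, any decoration and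
SYMMETRIC twists, `𝔄(cfiMat D S t) ≡_{C^k} 𝔄(cfiMat D S t')` as soon as the LINEAR RE-CLEARING
CONDITION of the scheme `protAsc k D` holds (hypothesis `hlin`, the existence form of `COND_k(D)` over
positions: for every position `s`, lifted pebble `i`, previous latest pebble `i₀` and symmetric
prescription `d`, a correction `(ΔL, Δc)` agreeing with the remaining pebbles, with zero coboundary
change on the protected edges of `s − i` already protected in `s − i₀` and change `d` on the others). -/
theorem affinePebbleEquiv_of_condLin {k : ℕ} (D : Design d₀ r δ) (hD : D.Good)
    (S : V d₀ → V r → Bool) (t t' : V d₀ → V d₀ → Fin 2)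
    (ht : ∀ v w, t v w = t w v) (ht' : ∀ v w, t' v w = t' w v)
    (hlin : ∀ (s : Pos k (d₀ + r)) (i i₀ : Fin k) (d : V d₀ → V d₀ → Fin 2), (∀ v w, d v w = d w v) →
      ∃ (ΔL : V d₀ → V r) (Δc : V r),
        (∀ v w, ΔL (v + w) = ΔL v + ΔL w) ∧
        (∀ j, j ≠ i → ∀ x, s j = some (.inl x) → ΔL (base x) + Δc = 0) ∧
        (∀ j, j ≠ i → ∀ ξ, s j = some (.inr ξ) → transp ΔL (fib ξ) = 0) ∧
        (∀ (v : V d₀) (idx : Fin δ), protAsc k D (Function.update s i none) v (v + D.gen idx) = true →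
          (protAsc k D (Function.update s i₀ none) v (v + D.gen idx) = true →
            cobd D (fun u => ΔL u + Δc) v (v + D.gen idx) = 0) ∧
          (¬ protAsc k D (Function.update s i₀ none) v (v + D.gen idx) = true →
            cobd D (fun u => ΔL u + Δc) v (v + D.gen idx) = d v (v + D.gen idx)))) :
    AffinePebbleEquiv k (d₀ + r) (cfiMat D S t) (cfiMat D S t') := by
  refine affinePebbleEquiv_of_linear' D hD S t t' ht ht' (fun s v w => protAsc k D s v w = true)
    (fun v w h => ?_) (fun s v w hpin => ?_) hlin
  · rw [protAsc_empty] at h; exact Bool.false_ne_true h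
  · obtain ⟨j, x, hj, rfl⟩ := hpin
    exact ⟨protAsc_of_pinned_left D s _ w (pinned_of_mem s j x hj),
      protAsc_of_pinned_right D s w _ (pinned_of_mem s j x hj)⟩

end Summit.ValiantsHypothesis.ValiantsHypothesis.Theorems.SymmetryDialCondScheme
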